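import Summits.ResolutionOfSingularities.ResolutionOfSingularities.Theorems.HilbertSamuelEliminationSigmaMaxModificationsCorridor3WLadderIsoInsepSplitMilnorJacobianRow
import Literature.RingTheory.MvPowerSeries.SumEquiv
import Literature.AlgebraicGeometry.Deformation.ObstructionSpaceDimensionBound
import Mathlib.RingTheory.Artinian.Ring
import HarnessLib

/-!
# [OURS · L1 W4.2] k2 row S-fin₂, ALGEBRA half, part 2/2: the Milnor algebra of a split shadow is finite as soon as the Jacobian row of
# `x² + λy² + g(z,w)` does not vanish at any non-maximal prime (crux chain w42, cell k2 `T3insep`, `--supports stmt-…-19249`)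

OURS (cell res-hironaka, slot W4.2, seat res-D-pv-042; res-L1-w42-plan-1 RULING v3.14-16a (EU), CUT 12:02:38Z); NOT a statement of
[Hironaka2017] nor of [CossartJannsenSaito2020] / [Matsumura1987]. AI-drafted, weaker than expert review. HELPER file: no row is closed
here; it is the pure commutative algebra behind `IdeasL1C6.SplitMilnorFinite₂` (k2 PART 2′, `…Corridor3WLadderIsoInsepCellsDefs`),
split in two files by the 400-line rule: `…IsoInsepSplitMilnorJacobianRow` = §1–§2 (imported); THIS file = §3–§4.

Setting: `κ` a field of characteristic `2` of 2-rank one presented by `λ` (`λ ∉ κ²`, `κ = κ² + λκ²` — the `hpb` clause of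
`IsPBSplitInsepAt`), `g ∈ κ⟦z,w⟧` without constant and linear terms, `F = splitEq 2 λ g = x² + λy² + g(z,w) ∈ S = κ⟦x,y,z,w⟧`.

* §1 `lamSqPart` — under `hpb` every `c ∈ κ` is `a² + λb²` with `b²` UNIQUE (`λ ∉ κ²`); every derivation `D ∈ Der(κ)` kills squares
  (characteristic two), so `D c = D(λ)·b²` (`derivation_apply_eq_mul_lamSqPart`).  Coefficientwise: `lamPart g` and
  `coeffDerivation D g = D(λ) • lamPart g`.
* §2 the JACOBIAN ROW of `F`: `∂_x F = ∂_y F = 0`, `∂_z F, ∂_w F` = the renamed `g_z, g_w`, and `D̃ F = D(λ)·(y² + lamPart g)` for EVERY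
  `D ∈ Der(κ)` — so the whole row lies in the ideal `𝔍 = (g_z, g_w, y² + lamPart g) S`, independently of `D`.
* §3 THE PRIME: if the Milnor algebra `κ⟦z,w⟧/(g_z, g_w)` is NOT finite over `κ`, then `Λ := κ⟦z,w⟧/(g_z, g_w)` has Krull dimension
  `≥ 1` (a zero-dimensional quotient contains a power of `𝔪` and is finite), and reading `S = (κ⟦z,w⟧)⟦x,y⟧`
  (`Literature.RingTheory.MvPowerSeries.SumEquiv.sumAlgEquiv`, Zariski–Samuel II Ch. VII §1) the surjection `Θ : S ↠ Λ⟦x,y⟧` sends `F` into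
  `I = (x² + ā′, y² + b̄′)` (`b′ = lamPart g`, `a′ = g + λb′`; characteristic two); Krull's height theorem over the local ring `Λ`
  (`relPowerSeries_le_ringKrullDim_quotient_add_spanFinrank`: `dim Λ + 2 ≤ dim Λ⟦x,y⟧/I + μ(I)`) gives `dim Λ⟦x,y⟧/I ≥ 1`, hence a
  NON-MAXIMAL prime `𝔓 ⊇ I`, and `P = Θ⁻¹𝔓` is a non-maximal prime of `S` containing `F` and its whole Jacobian row
  (`exists_prime_jacobian_vanishes_of_not_finite`).
* §4 CONCLUSION `moduleFinite_milnorAlg_of_jacobian`: if at every non-maximal prime `P ∋ F` some entry of the Jacobian row is NOT in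
  `P` (the output shape of Nagata's criterion, `Literature.AlgebraicGeometry.Resolution.Matsumura1987_30_10_hypersurface`, fed by the
  REGULARITY of `S_P/(F)` which the scheme side derives from isolation — file `…IsoInsepSplitMilnorFinite`), then
  `Module.Finite κ (MilnorAlg g)`.

References (pointers only): [Matsumura1987, Thm. 30.10, Thm. 13.5/13.6]; W4.1 `WildCones.MuDropCharTwoOrdP` (the Milnor algebra carrier).
-/

noncomputable section

set_option linter.dupNamespace false

open scoped Classical
open MvPowerSeries IsLocalRing
open Literature.AlgebraicGeometry.Resolution
open Literature.RingTheory.MvPowerSeries.SumEquiv (sumAlgEquiv sumAlgEquiv_X_inl sumAlgEquiv_rename_inr sumAlgEquiv_C)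

namespace Summit.ResolutionOfSingularities.ResolutionOfSingularities.Cruxes.SigmaMaxModifications.IdeasL1C6

/-! ## §3. The prime: a non-finite Milnor algebra yields a non-maximal prime containing `F` and its Jacobian row -/

section ThePrime

variable {κ : Type} [Field κ]

/-- The Jacobian ideal `(g_z, g_w)` of a series without linear terms lies in the maximal ideal. [folklore] -/
theorem span_pderiv_le_maximalIdeal {g : MvPowerSeries (Fin 2) κ} (hg1 : ∀ s : Fin 2, coeff (Finsupp.single s 1) g = 0) :
    Ideal.span (Set.range fun s => MvPowerSeries.pderiv s g) ≤ maximalIdeal (MvPowerSeries (Fin 2) κ) := by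
  rw [Ideal.span_le]
  rintro _ ⟨s, rfl⟩
  rw [SetLike.mem_coe, Literature.RingTheory.MvPowerSeries.Jets.mem_maximalIdeal_iff_constantCoeff_eq_zero,
    ← coeff_zero_eq_constantCoeff_apply, MvPowerSeries.coeff_pderiv]
  simp [hg1 s]

/-- **A quotient of `κ⟦z,w⟧` by an ideal inside `𝔪` which is NOT finite over `κ` has Krull dimension `≥ 1`**: a zero-dimensional
noetherian local ring has a nilpotent maximal ideal, so the quotient would be a quotient of some `κ⟦z,w⟧/𝔪^k`, which is finite
over `κ`. [folklore] -/
theorem one_le_ringKrullDim_quotient_of_not_finite {σ : Type*} [Finite σ] (J : Ideal (MvPowerSeries σ κ))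
    (hJ : J ≤ maximalIdeal (MvPowerSeries σ κ)) (hfin : ¬ Module.Finite κ (MvPowerSeries σ κ ⧸ J)) :
    1 ≤ ringKrullDim (MvPowerSeries σ κ ⧸ J) := by
  haveI : IsNoetherianRing (MvPowerSeries σ κ) := isNoetherianRing_mvPowerSeries κ σ
  have hJtop : J ≠ ⊤ := fun h => (maximalIdeal.isMaximal (MvPowerSeries σ κ)).ne_top (top_le_iff.mp (h ▸ hJ))
  haveI : Nontrivial (MvPowerSeries σ κ ⧸ J) := Ideal.Quotient.nontrivial_iff.mpr hJtop
  haveI : IsLocalRing (MvPowerSeries σ κ ⧸ J) := IsLocalRing.of_surjective' _ Ideal.Quotient.mk_surjective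
  by_contra hlt
  rw [not_le] at hlt
  -- dimension `0`
  have h0 : ringKrullDim (MvPowerSeries σ κ ⧸ J) = 0 := by
    obtain ⟨n, hn⟩ := WithBot.ne_bot_iff_exists.mp (ringKrullDim_ne_bot (R := MvPowerSeries σ κ ⧸ J))
    have hnn : (0 : WithBot ℕ∞) ≤ ringKrullDim (MvPowerSeries σ κ ⧸ J) := ringKrullDim_nonneg_of_nontrivial
    rw [← hn] at hlt hnn ⊢
    have hn1 : n < 1 := WithBot.coe_lt_coe.mp (by exact_mod_cast hlt)
    have hn0 : n = 0 := Order.lt_one_iff.mp hn1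
    rw [hn0]; rfl
  haveI : Ring.KrullDimLE 0 (MvPowerSeries σ κ ⧸ J) := (Ring.krullDimLE_iff).mpr (le_of_eq h0)
  haveI : IsArtinianRing (MvPowerSeries σ κ ⧸ J) :=
    isArtinianRing_iff_isNoetherianRing_krullDimLE_zero.mpr ⟨inferInstance, inferInstance⟩
  -- the maximal ideal is nilpotent
  obtain ⟨k, hk⟩ := IsArtinianRing.isNilpotent_jacobson_bot (R := MvPowerSeries σ κ ⧸ J)
  rw [IsLocalRing.jacobson_eq_maximalIdeal ⊥ bot_ne_top] at hk
  -- hence `𝔪^k ⊆ J`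
  have hmk : maximalIdeal (MvPowerSeries σ κ) ^ k ≤ J := by
    have h1 : (maximalIdeal (MvPowerSeries σ κ)).map (Ideal.Quotient.mk J) ≤ maximalIdeal (MvPowerSeries σ κ ⧸ J) :=
      ((IsLocalRing.local_hom_TFAE (Ideal.Quotient.mk J)).out 0 2).mp
        (Ideal.Quotient.mk_surjective.isLocalHom (Ideal.Quotient.mk J))
    have h2 : ((maximalIdeal (MvPowerSeries σ κ)) ^ k).map (Ideal.Quotient.mk J) = ⊥ := by
      rw [Ideal.map_pow]
      refine le_bot_iff.mp ?_
      calc ((maximalIdeal (MvPowerSeries σ κ)).map (Ideal.Quotient.mk J)) ^ k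
          ≤ maximalIdeal (MvPowerSeries σ κ ⧸ J) ^ k := Ideal.pow_right_mono h1 k
        _ = ⊥ := by rw [hk, Ideal.zero_eq_bot]
    rw [← Ideal.mk_ker (I := J)]
    exact (Ideal.map_eq_bot_iff_le_ker _).mp h2
  -- so the quotient is a quotient of `κ⟦x⟧/𝔪^k`, finite over `κ`
  apply hfin
  haveI := Literature.RingTheory.MvPowerSeries.Jets.finite_quotient_maximalIdeal_pow (σ := σ) (K := κ) k
  refine Module.Finite.of_surjective (Ideal.Quotient.factorₐ κ hmk).toLinearMap ?_
  intro x
  obtain ⟨y, rfl⟩ := Ideal.Quotient.mk_surjective x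
  exact ⟨Ideal.Quotient.mk _ y, rfl⟩

/-- `MvPowerSeries.map` along a surjective ring map is surjective (lift coefficientwise). [folklore] -/
theorem map_surjective_of_surjective {σ R T : Type*} [CommRing R] [CommRing T] (f : R →+* T) (hf : Function.Surjective f) :
    Function.Surjective (MvPowerSeries.map (σ := σ) f) := by
  intro G
  refine ⟨fun e => Function.surjInv hf (G e), ?_⟩
  ext e
  rw [coeff_map]
  exact Function.surjInv_eq hf (G e)

/-- The reading map `Θ : κ⟦x,y,z,w⟧ → Λ⟦x,y⟧` (split the variables `{x,y} ⊔ {z,w}`, then reduce the coefficients `κ⟦z,w⟧ → Λ`).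
[folklore] -/
def theta {Λ : Type} [CommRing Λ] (π : MvPowerSeries (Fin 2) κ →+* Λ) : MvPowerSeries (Fin 4) κ →+* MvPowerSeries (Fin 2) Λ :=
  (MvPowerSeries.map (σ := Fin 2) π).comp
    ((sumAlgEquiv (Fin 2) (Fin 2) κ).toRingEquiv.toRingHom.comp
      (rename ((finSumFinEquiv (m := 2) (n := 2)).symm : Fin 4 → Fin 2 ⊕ Fin 2)).toRingHom)

/-- Unfolding `Θ`. [folklore] -/
theorem theta_apply {Λ : Type} [CommRing Λ] (π : MvPowerSeries (Fin 2) κ →+* Λ) (f : MvPowerSeries (Fin 4) κ) :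
    theta π f = MvPowerSeries.map (σ := Fin 2) π
      (sumAlgEquiv (Fin 2) (Fin 2) κ (rename ((finSumFinEquiv (m := 2) (n := 2)).symm : Fin 4 → Fin 2 ⊕ Fin 2) f)) := rfl

/-- `Θ` on the first two variables: `Θ (X (castAdd 2 i)) = X i`. [folklore] -/
theorem theta_X_castAdd {Λ : Type} [CommRing Λ] (π : MvPowerSeries (Fin 2) κ →+* Λ) (i : Fin 2) :
    theta π (X (Fin.castAdd 2 i)) = X i := by
  rw [theta_apply, rename_X, finSumFinEquiv_symm_apply_castAdd, sumAlgEquiv_X_inl, map_X]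

/-- `Θ` on a series in the last two variables: `Θ (h(z,w)) = C (π h)`. [folklore] -/
theorem theta_rename_natAdd {Λ : Type} [CommRing Λ] (π : MvPowerSeries (Fin 2) κ →+* Λ) (h : MvPowerSeries (Fin 2) κ) :
    theta π (rename (Fin.natAdd 2) h) = C (π h) := by
  have hcomp : (((finSumFinEquiv (m := 2) (n := 2)).symm : Fin 4 → Fin 2 ⊕ Fin 2) ∘ Fin.natAdd 2) =
      ⇑(Function.Embedding.inr : Fin 2 ↪ Fin 2 ⊕ Fin 2) := by
    funext j; exact finSumFinEquiv_symm_apply_natAdd j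
  have hren : rename ((finSumFinEquiv (m := 2) (n := 2)).symm : Fin 4 → Fin 2 ⊕ Fin 2) (rename (Fin.natAdd 2) h) =
      rename (Function.Embedding.inr : Fin 2 ↪ Fin 2 ⊕ Fin 2) h := by
    rw [rename_rename]
    simp only [hcomp]
  rw [theta_apply, hren, sumAlgEquiv_rename_inr, map_C]

/-- `Θ` on constants: `Θ (C c) = C (π (C c))`. [folklore] -/
theorem theta_C {Λ : Type} [CommRing Λ] (π : MvPowerSeries (Fin 2) κ →+* Λ) (c : κ) :
    theta π (C c) = C (π (C c)) := by
  have hc : (C c : MvPowerSeries (Fin 4) κ) = rename (Fin.natAdd 2 : Fin 2 → Fin 4) (C c : MvPowerSeries (Fin 2) κ) :=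
    (rename_C (Fin.natAdd 2 : Fin 2 → Fin 4) c).symm
  rw [hc, theta_rename_natAdd]

/-- `Θ` is surjective when `π` is. [folklore] -/
theorem theta_surjective {Λ : Type} [CommRing Λ] {π : MvPowerSeries (Fin 2) κ →+* Λ} (hπ : Function.Surjective π) :
    Function.Surjective (theta π) := by
  intro G
  obtain ⟨G₁, rfl⟩ := map_surjective_of_surjective (σ := Fin 2) π hπ G
  obtain ⟨G₂, rfl⟩ := (sumAlgEquiv (Fin 2) (Fin 2) κ).surjective G₁
  obtain ⟨G₃, rfl⟩ := (renameEquiv κ ((finSumFinEquiv (m := 2) (n := 2)).symm)).surjective G₂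
  exact ⟨G₃, rfl⟩

/-- A power series over a local ring whose constant coefficient is in `𝔪` lies in the maximal ideal. [folklore] -/
theorem mem_maximalIdeal_of_constantCoeff_mem {σ R : Type*} [CommRing R] [IsLocalRing R] {f : MvPowerSeries σ R}
    (h : constantCoeff f ∈ maximalIdeal R) : f ∈ maximalIdeal (MvPowerSeries σ R) := by
  rw [IsLocalRing.mem_maximalIdeal, mem_nonunits_iff] at h ⊢
  exact fun hu => h (hu.map constantCoeff)

/-- Arithmetic in `WithBot ℕ∞`: `a + 2 ≤ d + 2` with `1 ≤ a` forces `0 < d`. [folklore] -/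
theorem pos_of_add_two_le_add_two {a d : WithBot ℕ∞} (ha : 1 ≤ a) (h : a + 2 ≤ d + 2) : 0 < d := by
  induction a using WithBot.recBotCoe with
  | bot => exact absurd ha (by decide)
  | coe a =>
    have ha' : (1 : ℕ∞) ≤ a := by exact_mod_cast ha
    induction d using WithBot.recBotCoe with
    | bot =>
      rw [WithBot.bot_add] at h
      rcases WithBot.add_eq_bot.mp (le_bot_iff.mp h) with h1 | h1
      · exact absurd h1 WithBot.coe_ne_bot
      · exact absurd h1 (by decide)
    | coe n =>
      have h' : a + 2 ≤ n + 2 := by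
        have e : ∀ m : ℕ∞, (m : WithBot ℕ∞) + 2 = ((m + 2 : ℕ∞) : WithBot ℕ∞) := fun m => rfl
        rw [e, e, WithBot.coe_le_coe] at h
        exact h
      have hne : (2 : ℕ∞) ≠ ⊤ := by decide
      have h2 : a ≤ n := (WithTop.add_le_add_iff_right hne).mp h'
      have hn : 0 < n := lt_of_lt_of_le zero_lt_one (ha'.trans h2)
      exact_mod_cast hn

/-- **THE PRIME.** For `κ` of characteristic two and 2-rank one (`hlam`, `hpb`) and `g ∈ κ⟦z,w⟧` without constant and linear terms:
if the Milnor algebra `κ⟦z,w⟧/(g_z, g_w)` is NOT finite over `κ`, there is a NON-MAXIMAL prime `P` of `κ⟦x,y,z,w⟧` containing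
`F = x² + λy² + g`, all `∂F/∂X_i` and `D̃F` for every `D ∈ Der(κ)`. (Krull's height theorem over `Λ = κ⟦z,w⟧/(g_z,g_w)` read through
`κ⟦x,y,z,w⟧ = (κ⟦z,w⟧)⟦x,y⟧`; see the module docstring.) [OURS · L1 W4.2 · k2 S-fin₂] [folklore] -/
theorem exists_prime_jacobian_vanishes_of_not_finite [CharP κ 2] {lam : κ} (hlam : ∀ c : κ, c ^ 2 ≠ lam)
    (hpb : ∀ c : κ, ∃ a b : κ, c = a ^ 2 + lam * b ^ 2) {g : MvPowerSeries (Fin 2) κ} (hg0 : constantCoeff g = 0)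
    (hg1 : ∀ s : Fin 2, coeff (Finsupp.single s 1) g = 0) (hfin : ¬ Module.Finite κ (MilnorAlg g)) :
    ∃ P : Ideal (MvPowerSeries (Fin 4) κ), P.IsPrime ∧ P ≠ maximalIdeal _ ∧ splitEq 2 lam g ∈ P ∧
      (∀ i, MvPowerSeries.pderiv i (splitEq 2 lam g) ∈ P) ∧
      ∀ D : Derivation ℤ κ κ, MvPowerSeries.coeffDerivation D (splitEq 2 lam g) ∈ P := by
  haveI : IsNoetherianRing (MvPowerSeries (Fin 2) κ) := isNoetherianRing_mvPowerSeries κ (Fin 2)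
  -- the Milnor algebra `Λ = κ⟦z,w⟧/J`
  set J : Ideal (MvPowerSeries (Fin 2) κ) := Ideal.span (Set.range fun s => MvPowerSeries.pderiv s g) with hJdef
  have hJ : J ≤ maximalIdeal _ := span_pderiv_le_maximalIdeal hg1
  have hJtop : J ≠ ⊤ := fun h => (maximalIdeal.isMaximal (MvPowerSeries (Fin 2) κ)).ne_top (top_le_iff.mp (h ▸ hJ))
  set Λ := MvPowerSeries (Fin 2) κ ⧸ J with hΛ
  haveI : Nontrivial Λ := Ideal.Quotient.nontrivial_iff.mpr hJtop
  haveI : IsLocalRing Λ := IsLocalRing.of_surjective' _ Ideal.Quotient.mk_surjective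
  have hdimΛ : 1 ≤ ringKrullDim Λ := one_le_ringKrullDim_quotient_of_not_finite J hJ hfin
  set π : MvPowerSeries (Fin 2) κ →+* Λ := Ideal.Quotient.mk J with hπ
  have hπs : Function.Surjective π := Ideal.Quotient.mk_surjective
  haveI : IsLocalHom π := hπs.isLocalHom π
  -- the ideal `I = (x² + ā', y² + b̄')` of `T = Λ⟦x,y⟧`
  set b' : MvPowerSeries (Fin 2) κ := lamPart lam hpb g with hb'
  set a' : MvPowerSeries (Fin 2) κ := g + C lam * b' with ha'
  set u : MvPowerSeries (Fin 2) Λ := X 0 ^ 2 + C (π a') with hu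
  set v : MvPowerSeries (Fin 2) Λ := X 1 ^ 2 + C (π b') with hv
  set I : Ideal (MvPowerSeries (Fin 2) Λ) := Ideal.span {u, v} with hI
  have hb'0 : constantCoeff b' = 0 := constantCoeff_lamPart hlam hpb hg0
  have ha'0 : constantCoeff a' = 0 := by
    rw [ha', map_add, map_mul, hg0, hb'0, mul_zero, add_zero]
  have hmemΛ : ∀ c : MvPowerSeries (Fin 2) κ, constantCoeff c = 0 → π c ∈ maximalIdeal Λ := by
    intro c hc
    have hc' : c ∈ maximalIdeal (MvPowerSeries (Fin 2) κ) :=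
      Literature.RingTheory.MvPowerSeries.Jets.mem_maximalIdeal_iff_constantCoeff_eq_zero.mpr hc
    rw [IsLocalRing.mem_maximalIdeal, mem_nonunits_iff] at hc' ⊢
    exact fun hu => hc' (IsLocalHom.map_nonunit c hu)
  have hu𝔪 : u ∈ maximalIdeal _ := mem_maximalIdeal_of_constantCoeff_mem (by
    rw [hu, map_add, map_pow, constantCoeff_X, zero_pow two_ne_zero, zero_add, constantCoeff_C]
    exact hmemΛ a' ha'0)
  have hv𝔪 : v ∈ maximalIdeal _ := mem_maximalIdeal_of_constantCoeff_mem (by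
    rw [hv, map_add, map_pow, constantCoeff_X, zero_pow two_ne_zero, zero_add, constantCoeff_C]
    exact hmemΛ b' hb'0)
  have hIle : I ≤ maximalIdeal _ := by
    rw [hI, Ideal.span_le]
    intro w hw
    rcases hw with rfl | hw
    · exact hu𝔪
    · rw [Set.mem_singleton_iff.mp hw]; exact hv𝔪
  have hItop : I ≠ ⊤ := fun h => (maximalIdeal.isMaximal (MvPowerSeries (Fin 2) Λ)).ne_top (top_le_iff.mp (h ▸ hIle))
  -- Krull: `dim Λ + 2 ≤ dim T/I + μ(I)`, `μ(I) ≤ 2`, `dim Λ ≥ 1` ⇒ `dim T/I > 0`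
  have hK := Literature.AlgebraicGeometry.Deformation.ProRep.relPowerSeries_le_ringKrullDim_quotient_add_spanFinrank Λ I hItop
  have hμ : I.spanFinrank ≤ 2 := by
    have hfin2 : ({u, v} : Set (MvPowerSeries (Fin 2) Λ)).Finite := Set.toFinite _
    refine (Submodule.spanFinrank_span_le_ncard_of_finite hfin2).trans ?_
    exact (Set.ncard_insert_le u {v}).trans (by rw [Set.ncard_singleton])
  have hdimTI : 0 < ringKrullDim (MvPowerSeries (Fin 2) Λ ⧸ I) := by
    refine pos_of_add_two_le_add_two hdimΛ (hK.trans ?_)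
    have hμ' : (I.spanFinrank : WithBot ℕ∞) ≤ 2 := by exact_mod_cast hμ
    calc ringKrullDim (MvPowerSeries (Fin 2) Λ ⧸ I) + (I.spanFinrank : WithBot ℕ∞)
        ≤ ringKrullDim (MvPowerSeries (Fin 2) Λ ⧸ I) + 2 := add_le_add le_rfl hμ'
      _ = ringKrullDim (MvPowerSeries (Fin 2) Λ ⧸ I) + ((2 : ℕ) : WithBot ℕ∞) := by norm_cast
  -- a non-maximal prime `𝔓 ⊇ I` of `T`
  obtain ⟨p, q, hpq⟩ := Order.krullDim_pos_iff.mp hdimTI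
  set 𝔓 : Ideal (MvPowerSeries (Fin 2) Λ) := p.asIdeal.comap (Ideal.Quotient.mk I) with h𝔓
  haveI h𝔓p : 𝔓.IsPrime := Ideal.IsPrime.comap (Ideal.Quotient.mk I)
  have hI𝔓 : I ≤ 𝔓 := fun w hw => by
    rw [h𝔓, Ideal.mem_comap, Ideal.Quotient.eq_zero_iff_mem.mpr hw]
    exact zero_mem _
  have h𝔓ne : 𝔓 ≠ maximalIdeal _ := by
    intro h𝔓m
    have hq : q.asIdeal.comap (Ideal.Quotient.mk I) ≤ maximalIdeal _ :=
      IsLocalRing.le_maximalIdeal (Ideal.IsPrime.ne_top (Ideal.IsPrime.comap (Ideal.Quotient.mk I)))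
    have hpq' : p.asIdeal < q.asIdeal := hpq
    have hlt : 𝔓 < q.asIdeal.comap (Ideal.Quotient.mk I) :=
      lt_of_le_of_ne (Ideal.comap_mono hpq'.le)
        (fun h => hpq'.ne (Ideal.comap_injective_of_surjective _ Ideal.Quotient.mk_surjective h))
    exact absurd (h𝔓m ▸ hlt) (not_lt_of_ge hq)
  -- pull back along `Θ`
  have hθs : Function.Surjective (theta π) := theta_surjective hπs
  refine ⟨𝔓.comap (theta π), Ideal.IsPrime.comap (theta π), ?_, ?_, ?_, ?_⟩
  · -- non-maximal
    intro hP
    have hmax : (maximalIdeal (MvPowerSeries (Fin 2) Λ)).comap (theta π) = maximalIdeal (MvPowerSeries (Fin 4) κ) := by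
      haveI := Ideal.comap_isMaximal_of_surjective (theta π) hθs (K := maximalIdeal (MvPowerSeries (Fin 2) Λ))
      exact IsLocalRing.eq_maximalIdeal inferInstance
    exact h𝔓ne (Ideal.comap_injective_of_surjective (theta π) hθs (hP.trans hmax.symm))
  · -- `F ∈ P`: `Θ F = u + C(π(C λ)) * v`
    rw [Ideal.mem_comap]
    have h0 : theta π (X 0 ^ 2) = X 0 ^ 2 := by
      rw [map_pow, show (0 : Fin 4) = Fin.castAdd 2 0 from rfl, theta_X_castAdd]
    have h1 : theta π (C lam * X 1 ^ 2) = C (π (C lam)) * X 1 ^ 2 := by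
      rw [map_mul, map_pow, show (1 : Fin 4) = Fin.castAdd 2 1 from rfl, theta_X_castAdd, theta_C]
    have hga : π g = π a' + π (C lam) * π b' := by
      rw [← map_mul, ← map_add, ha', add_assoc, ← add_mul, ← map_add, CharTwo.add_self_eq_zero, map_zero, zero_mul,
        add_zero]
    have hF : theta π (splitEq 2 lam g) = u + C (π (C lam)) * v := by
      unfold splitEq
      rw [map_add, map_add, h0, h1, theta_rename_natAdd, hga, hu, hv, map_add, map_mul]
      ring
    rw [hF]
    exact Ideal.add_mem _ (hI𝔓 (Ideal.subset_span (by simp)))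
      (Ideal.mul_mem_left _ _ (hI𝔓 (Ideal.subset_span (by simp))))
  · -- the partial derivatives
    intro i
    rw [Ideal.mem_comap]
    obtain ⟨j, rfl⟩ | ⟨j, rfl⟩ : (∃ j : Fin 2, Fin.castAdd 2 j = i) ∨ ∃ j : Fin 2, Fin.natAdd 2 j = i := by
      rcases (finSumFinEquiv (m := 2) (n := 2)).surjective i with ⟨x, rfl⟩
      rcases x with j | j
      · exact Or.inl ⟨j, (finSumFinEquiv_apply_left (n := 2) j).symm⟩
      · exact Or.inr ⟨j, (finSumFinEquiv_apply_right (m := 2) j).symm⟩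
    · rw [pderiv_splitEq_castAdd, map_zero]; exact zero_mem _
    · rw [pderiv_splitEq_natAdd, theta_rename_natAdd]
      have : π (MvPowerSeries.pderiv j g) = 0 :=
        Ideal.Quotient.eq_zero_iff_mem.mpr (Ideal.subset_span ⟨j, rfl⟩)
      rw [this, map_zero]; exact zero_mem _
  · -- the coefficient derivations
    intro D
    rw [Ideal.mem_comap, coeffDerivation_splitEq hpb, MvPowerSeries.smul_eq_C_mul, map_mul, map_add, map_pow,
      show (1 : Fin 4) = Fin.castAdd 2 1 from rfl, theta_X_castAdd, theta_rename_natAdd]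
    refine Ideal.mul_mem_left _ _ (hI𝔓 (Ideal.subset_span (Set.mem_insert_of_mem u ?_)))
    rw [Set.mem_singleton_iff, hv, hb']

end ThePrime

/-! ## §4. Conclusion: Jacobian non-vanishing at every non-maximal prime forces a finite Milnor algebra -/

section Conclusion

variable {κ : Type} [Field κ]

/-- **S-fin₂, algebra half.** For `κ` of characteristic two and 2-rank one (`λ ∉ κ²`, `κ = κ² + λκ²`) and `g ∈ κ⟦z,w⟧` without constant
and linear terms: if at every NON-MAXIMAL prime `P ∋ F = x² + λy² + g(z,w)` of `κ⟦x,y,z,w⟧` some entry of the Jacobian row of `F`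
(`∂F/∂X_i`, or `D̃F` for some `D ∈ Der(κ)`) is NOT in `P` — the conclusion of Nagata's criterion at the primes where `κ⟦X⟧_P/(F)` is
regular — then the Milnor algebra `κ⟦z,w⟧/(g_z, g_w)` is finite over `κ`. [OURS · L1 W4.2 · k2 S-fin₂] [folklore] -/
theorem moduleFinite_milnorAlg_of_jacobian [CharP κ 2] {lam : κ} (hlam : ∀ c : κ, c ^ 2 ≠ lam)
    (hpb : ∀ c : κ, ∃ a b : κ, c = a ^ 2 + lam * b ^ 2) {g : MvPowerSeries (Fin 2) κ} (hg0 : constantCoeff g = 0)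
    (hg1 : ∀ s : Fin 2, coeff (Finsupp.single s 1) g = 0)
    (hJ : ∀ P : Ideal (MvPowerSeries (Fin 4) κ), P.IsPrime → P ≠ maximalIdeal _ → splitEq 2 lam g ∈ P →
      (∃ i, MvPowerSeries.pderiv i (splitEq 2 lam g) ∉ P) ∨
        ∃ D : Derivation ℤ κ κ, MvPowerSeries.coeffDerivation D (splitEq 2 lam g) ∉ P) :
    Module.Finite κ (MilnorAlg g) := by
  by_contra hfin
  obtain ⟨P, hP, hPm, hF, hd, hD⟩ := exists_prime_jacobian_vanishes_of_not_finite hlam hpb hg0 hg1 hfin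
  rcases hJ P hP hPm hF with ⟨i, hi⟩ | ⟨D, hDD⟩
  · exact hi (hd i)
  · exact hDD (hD D)

end Conclusion

end Summit.ResolutionOfSingularities.ResolutionOfSingularities.Cruxes.SigmaMaxModifications.IdeasL1C6

end
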